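import Summits.ValiantsHypothesis.ValiantsHypothesis.Theorems.BarrierLeverAnchoredDoorHitsLowerPairsEvalDoor

/-!
# Support item `AnchoredDoorHitsLowerPairs` (stmt-ValiantsHypothesis-22510), line `anchored-peeling`:
# THE PENDANT STEP — attaching the LAST column vertex by ONE BARE ANCHOR to any row vertex of at-least-equal star

Helper file (`--supports stmt-ValiantsHypothesis-22510`; cell valiant-natproofs, rung V4, 𝒟-side door (c); registered line
`Cruxes/AnchoredDoorHitsLowerPairs/Lines/anchored_peeling.lean` v30 (registered stubs `stub_conjBiEval`, `stub_ltRestNonCanonRSWPD`,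
`stub_vertexStep`, `stub_lefStep`, `stub_crossed`, `stub_sr`, `stub_conjM`); prover seat val-np-p1 gen 29; memo
HOME/val-np-p1/g29/MEMO-udoor-valnp1-g29.md §5). Closes NO item.

WHAT. The STAR STEP (p580598) peels a pair `(a₀ | e₀)` of vertices with EQUAL star counts `|St_R a₀| = |St_C e₀|`; rigid pairs have no such
pair. Numerically the INEQUALITY suffices: for every injective lower pair `(u, w)`, every column vertex `e₀` and every row vertex `a₀` with
`|St_R a₀| ≥ |St_C e₀|`, the member of 𝔄₁ which is a generic three-matrix door (`uDoorPoint`, file `…UDoor`) on the column vertices OTHER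
than `e₀` (no `y`-tail ever touches `e₀`) times the single BARE anchor `1 + x_{a₀} y_{e₀}` (weight `1`, no tails; all other anchors at `e₀`
vanish) — `pendantPoint θ Φ Ψ a₀ e₀` — has nonzero partition minor on `(u, w)`. Its layout is the block matrix
`[ M_G[R, Del_{e₀} C] ∣ ([a₀ ∈ U] · M_G[U ∖ a₀, W ∖ e₀])_{U ∈ R, W ∋ e₀} ]` (`G` the three-matrix door on `X × (Y ∖ e₀)`), i.e. the map
`p ↦ (⟨G, p⟩ mod I_{Del}, ⟨G, ∂_{a₀} p⟩ mod I_{Lk})` on `Π_R`; at equal stars it is block-triangular (the star step), in the strict case it is a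
Laplace sum of products of NON-lower minors of `G` (total-nonsingularity territory, cf. `Stmt.conjUDoorTNS`). CENSUS (exact mod 2³¹−1,
lab/s1test.py; kit j331075 extends it): ALL strict instances `(u, w, a₀, e₀)` on ≤ 4+5 / 5+4 vertices (254 + 2 155 + 396) and every sampled instance on the
named pairs of the line up to `r = 64` nonsingular; the necessity of the inequality is plain (the `|St e₀|` columns through `e₀` are supported on
the `|St a₀|` rows through `a₀`). Since for ANY `(a₀, e₀)` one of `|St a₀| ≥ |St e₀|`, `|St e₀| ≥ |St a₀|` holds, the pendant step — unlike the star
step — ALWAYS applies (on one side or the other): `stub_vertexStep_of_conjPendantStep` derives the registered stub from it by name, and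
`anchoredDoorHitsLowerPairs_of_conjPendantStep` the route decl.
* `pendantPoint θ Φ Ψ a₀ e₀` — the parameter point.   * `Stmt.conjPendantStep` — the node (offered text).
* `symbolicDet_one_ne_zero_of_conjPendantStep`, `stub_vertexStep_of_conjPendantStep`, `stub_ltRestNonCanonRSW_of_conjPendantStep`,
  `anchoredDoorHitsLowerPairs_of_conjPendantStep`.
WHY IT MIGHT FAIL: a lower pair and `(a₀, e₀)` with `|St a₀| > |St e₀|` where the bare attachment is identically singular (none found); the
analogous statement with TWO bare pendant columns is false exactly when two columns collide (`W ↦ (a(W ∩ E), W ∖ E)` not injective) or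
Hall fails for the support — and, numerically, ONLY then (memo §5: 0 exceptions among 3 209 criterion instances at 4+4, k ≤ 4).

WHAT THIS IS NOT: `Stmt.conjPendantStep` is NOT proved here; nothing on crux stmt-ValiantsHypothesis-14610 or on `VP` versus `VNP`.
-/

set_option linter.dupNamespace false

namespace Summit.ValiantsHypothesis.ValiantsHypothesis.Theorems.BarrierLever.AnchoredPeeling

open Finset MvPolynomial

noncomputable section

variable {h : ℕ}

/-- **The pendant point of 𝔄₁:** a three-matrix door `(θ, Φ, Ψ)` on the column vertices other than `e₀` (vertex anchor `(a | d)`, `d ≠ e₀`: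
weight `θ a d`, `x`-tail `Φ d b`, `y`-tail `Ψ a e` at `e ≠ e₀` and NONE at `e₀`), times the single bare anchor `(a₀ | e₀)` of weight `1`
(no tails); every other anchor `(a | e₀)` vanishes. Values on non-singleton anchors: the corresponding sums (irrelevant at profile 1). -/
def pendantPoint (θ Φ Ψ : Fin h → Fin h → ℂ) (a₀ e₀ : Fin h) : Param h → ℂ
  | Sum.inl β => ∑ a ∈ β.1, ∑ d ∈ β.2, (if d = e₀ then (if a = a₀ then 1 else 0) else θ a d)
  | Sum.inr (Sum.inl (β, b)) => ∑ d ∈ β.2, (if d = e₀ then 0 else Φ d b)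
  | Sum.inr (Sum.inr (β, e)) => if e = e₀ then 0 else ∑ a ∈ β.1, (if e₀ ∈ β.2 then 0 else Ψ a e)

/-- **CONJECTURE P — THE PENDANT STEP (offered node text).** For all `h`, `r`, every pair of injective enumerations `u`, `w` of lower
families, every column vertex `e₀` lying in some column and every row vertex `a₀` whose star in the rows is at least as large as the star
of `e₀` in the columns, SOME three matrices `θ Φ Ψ` make the profile-1 symbolic minor nonzero at `pendantPoint θ Φ Ψ a₀ e₀`. -/
def Stmt.conjPendantStep : Prop :=
  ∀ (h r : ℕ) (u w : Fin r → Finset (Fin h)), Function.Injective u → Function.Injective w →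
    IsLowerSet (Set.range u) → IsLowerSet (Set.range w) →
    ∀ (a₀ e₀ : Fin h), (∃ j, e₀ ∈ w j) →
      (Finset.univ.filter (fun j => e₀ ∈ w j)).card ≤ (Finset.univ.filter (fun i => a₀ ∈ u i)).card →
      ∃ θ Φ Ψ : Fin h → Fin h → ℂ, MvPolynomial.eval (pendantPoint θ Φ Ψ a₀ e₀) (symbolicDet 1 h r u w) ≠ 0

/-- An injective family with `2 ≤ r` members has a vertex (two members cannot both be empty). -/
theorem exists_vertex_of_two_le {r : ℕ} (u : Fin r → Finset (Fin h)) (hu : Function.Injective u) (hr : 2 ≤ r) :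
    ∃ (a : Fin h) (i : Fin r), a ∈ u i := by
  by_contra hcon
  have hempty : ∀ i : Fin r, u i = ∅ := fun i =>
    Finset.eq_empty_of_forall_notMem (fun a ha => hcon ⟨a, i, ha⟩)
  have h0 : u ⟨0, by omega⟩ = u ⟨1, by omega⟩ := by rw [hempty, hempty]
  have h01 := hu h0
  rw [Fin.ext_iff] at h01
  exact absurd h01 (by norm_num)

/-- **P ⟹ U1:** the pendant step applies to EVERY injective lower pair with `2 ≤ r` on one side or the other (for any used row vertex
`a₀` and used column vertex `e₀` one of the two star inequalities holds; the mirror case is transported by `symbolicDet_ne_zero_swap`),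
and `r ≤ 1` is `symbolicDet_of_le_one`. -/
theorem symbolicDet_one_ne_zero_of_conjPendantStep (hP : Stmt.conjPendantStep) (h r : ℕ) (u w : Fin r → Finset (Fin h))
    (hu : Function.Injective u) (hw : Function.Injective w) (hlu : IsLowerSet (Set.range u)) (hlw : IsLowerSet (Set.range w)) :
    symbolicDet 1 h r u w ≠ 0 := by
  by_cases hr : r ≤ 1
  · rw [symbolicDet_of_le_one 1 h r u w hlu hlw hr]
    exact one_ne_zero
  · have hr2 : 2 ≤ r := by omega
    obtain ⟨a₀, i₀, ha₀⟩ := exists_vertex_of_two_le u hu hr2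
    obtain ⟨e₀, j₀, he₀⟩ := exists_vertex_of_two_le w hw hr2
    by_cases hle : (Finset.univ.filter (fun j => e₀ ∈ w j)).card ≤ (Finset.univ.filter (fun i => a₀ ∈ u i)).card
    · obtain ⟨θ, Φ, Ψ, hne⟩ := hP h r u w hu hw hlu hlw a₀ e₀ ⟨j₀, he₀⟩ hle
      exact fun h0 => hne (by rw [h0, map_zero])
    · have hle' : (Finset.univ.filter (fun i => a₀ ∈ u i)).card ≤ (Finset.univ.filter (fun j => e₀ ∈ w j)).card := by omega
      obtain ⟨θ, Φ, Ψ, hne⟩ := hP h r w u hw hu hlw hlu e₀ a₀ ⟨i₀, ha₀⟩ hle'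
      exact symbolicDet_ne_zero_swap 1 h r u w (fun h0 => hne (by rw [h0, map_zero]))

/-- P at every profile `s ≥ 1`. -/
theorem symbolicDet_ne_zero_of_conjPendantStep (hP : Stmt.conjPendantStep) {s : ℕ} (hs : 1 ≤ s) (h r : ℕ)
    (u w : Fin r → Finset (Fin h)) (hu : Function.Injective u) (hw : Function.Injective w) (hlu : IsLowerSet (Set.range u))
    (hlw : IsLowerSet (Set.range w)) : symbolicDet s h r u w ≠ 0 :=
  symbolicDet_ne_zero_mono hs (symbolicDet_one_ne_zero_of_conjPendantStep hP h r u w hu hw hlu hlw)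

/-- **P ⟹ THE REGISTERED STUB `stub_vertexStep`** (outright). -/
theorem stub_vertexStep_of_conjPendantStep (hP : Stmt.conjPendantStep) : Stmt.stub_vertexStep := by
  intro h r u w hu hw hlu hlw _ _ _
  exact symbolicDet_one_ne_zero_of_conjPendantStep hP h r u w hu hw hlu hlw

/-- **P ⟹ the residual `Stmt.stub_ltRestNonCanonRSW` OUTRIGHT** (at `s = 1`, `h₀ = 0`). -/
theorem stub_ltRestNonCanonRSW_of_conjPendantStep (hP : Stmt.conjPendantStep) : Stmt.stub_ltRestNonCanonRSW := by
  refine ⟨1, 0, le_refl 1, ?_⟩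
  intro h _ r u w hu hw hlu hlw _ _ _ _ _ _ _ _ _ _ _ _ _
  exact symbolicDet_one_ne_zero_of_conjPendantStep hP h r u w hu hw hlu hlw

/-- **Composition BY NAME: `Stmt.conjPendantStep → AnchoredDoorHitsLowerPairs`.** -/
theorem anchoredDoorHitsLowerPairs_of_conjPendantStep (hP : Stmt.conjPendantStep) :
    Summit.ValiantsHypothesis.ValiantsHypothesis.Theses.BarrierLever.AnchoredDoorHitsLowerPairs :=
  anchoredDoorHitsLowerPairs_of_ltRestNonCanonRSW (stub_ltRestNonCanonRSW_of_conjPendantStep hP)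

end

end Summit.ValiantsHypothesis.ValiantsHypothesis.Theorems.BarrierLever.AnchoredPeeling
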